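import Summits.NavierStokesRegularity.FluidComputer.AngularGalerkinLadderLinearFlows
import Summits.NavierStokesRegularity.FluidComputer.AngularGalerkinLadderRadialCutoff
import Literature.Analysis.FluidPDE.HomogeneousEulerProofs

/-!
# The angular Galerkin ladder: explicit nontrivial inhabitants — smooth, compactly supported,
# divergence-free band-limited fields of degree `≤ 1` (localised swirls) (theorems only)

Cell `ns-blowup`, seat `ns-blowup-lean` (g10). LABEL: KERNEL typing hygiene for the vocabulary of
`FluidComputer/AngularGalerkinLadder.lean` (route `Theses/AngularGalerkinLadder.lean`). WHAT THIS IS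
NOT: not Navier–Stokes evidence — explicit KINEMATIC examples showing that the data classes of
the low rungs are inhabited by nonzero smooth compactly supported divergence-free fields; nothing
about the dynamics of any rung, no profile, no crux touched.

## Content

* `crossCLM_eq_toEuclideanCLM`: the linear field `x ↦ ω × x` is `x ↦ [ω]_× x` with the
  antisymmetric matrix `[ω]_×`; hence `isBandLimited_one_cross` (rigid rotations are degree `≤ 1`).
* `isBandLimited_one_radial_cross`: the LOCALISED SWIRL `x ↦ χ(‖x‖²) (ω × x)` (smooth radial
  profile `χ`) is band-limited of degree `≤ 1` (radial multipliers commute with the cut,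
  `IsBandLimited.radial_smul`), hence of every degree `L ≥ 1`;
* `isDivFree_radial_cross`: it is divergence free (`div(χ(‖x‖²) ω × x) = χ · tr[ω]_× +
  2χ'⟨x, ω × x⟩ = 0`); `hasCompactSupport_radial_cross`: compactly supported when `χ` is;
* `exists_nonzero_bandLimited_one_divFree_compactSupport`: **there is a nonzero smooth compactly
  supported divergence-free field band-limited of degree `≤ 1`** (take a bump `χ` with `χ(1) = 1`
  and `ω = e₂`: the field equals `e₂ × e₀ ≠ 0` at `e₀`) — so the admissible data of the rung
  Cauchy problems (`RungForwardTypeIBlowup L`, `L ≥ 1`, in the crux skeleton of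
  `RungBlowupCofinal`) and the test fields in `IsCobandLimited` are NON-VACUOUS classes.

References: [cite: BullardGellman1954] (degree-one vector harmonics `x × ∇Y_{1m}`);
[cite: MajdaBertozziCUP2002, §1.2 Prop. 1.1] (rigid rotations, divergence-free fields).
-/

noncomputable section

namespace Summit.NavierStokesRegularity.FluidComputer

open Set MeasureTheory Filter Topology Function Matrix
open scoped ContDiff RealInnerProductSpace
open Literature.Analysis.FluidPDE

namespace AngularLadder

/-! ## §1 Rigid rotations `x ↦ ω × x` are band-limited of degree `≤ 1` -/

/-- The cross-product map `x ↦ ω × x` is the linear field of the antisymmetric matrix `[ω]_×`.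
[folklore] -/
theorem crossCLM_eq_toEuclideanCLM (b : EuclideanSpace ℝ (Fin 3)) :
    ⇑(crossCLM b) = ⇑(Matrix.toEuclideanCLM (n := Fin 3) (𝕜 := ℝ)
      !![0, -b 2, b 1; b 2, 0, -b 0; -b 1, b 0, 0]) := by
  funext x
  apply PiLp.ext
  intro i
  fin_cases i <;>
    simp [crossCLM_apply, cross, cross_apply, Matrix.ofLp_toEuclideanCLM, Matrix.mulVec,
      dotProduct, Fin.sum_univ_three] <;> ring

/-- `[ω]_×` is antisymmetric. [folklore] -/
theorem crossMatrix_transpose (b : EuclideanSpace ℝ (Fin 3)) :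
    (!![0, -b 2, b 1; b 2, 0, -b 0; -b 1, b 0, 0] : Matrix (Fin 3) (Fin 3) ℝ)ᵀ =
      -!![0, -b 2, b 1; b 2, 0, -b 0; -b 1, b 0, 0] := by
  ext i j
  fin_cases i <;> fin_cases j <;> simp

/-- **Rigid rotations are band-limited of degree `≤ 1`**: `x ↦ ω × x` (isotype `j = 1`).
[folklore] -/
theorem isBandLimited_one_cross (b : EuclideanSpace ℝ (Fin 3)) :
    IsBandLimited 1 fun x => cross b x := by
  have h := isBandLimited_one_toEuclideanCLM_of_transpose_eq_neg _ (crossMatrix_transpose b)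
  rw [← crossCLM_eq_toEuclideanCLM] at h
  exact h

/-! ## §2 Localised swirls `x ↦ χ(‖x‖²) (ω × x)` -/

variable {χ : ℝ → ℝ}

/-- **The localised swirl is band-limited of degree `≤ 1`** (radial multipliers commute with
the cut). [folklore] -/
theorem isBandLimited_one_radial_cross (hχ : ContDiff ℝ ∞ χ) (b : EuclideanSpace ℝ (Fin 3)) :
    IsBandLimited 1 fun x => χ (‖x‖ ^ 2) • cross b x :=
  (isBandLimited_one_cross b).radial_smul hχ

/-- The localised swirl is band-limited of every degree `L ≥ 1`. [folklore] -/
theorem isBandLimited_radial_cross (hχ : ContDiff ℝ ∞ χ) (b : EuclideanSpace ℝ (Fin 3)) {L : ℕ}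
    (hL : 1 ≤ L) : IsBandLimited L fun x => χ (‖x‖ ^ 2) • cross b x :=
  (isBandLimited_one_radial_cross hχ b).mono hL

/-- The localised swirl has compact support when `χ` has. [folklore] -/
theorem hasCompactSupport_radial_cross (hχ : HasCompactSupport χ) (b : EuclideanSpace ℝ (Fin 3)) :
    HasCompactSupport fun x : EuclideanSpace ℝ (Fin 3) => χ (‖x‖ ^ 2) • cross b x :=
  hasCompactSupport_radial_smul hχ _

/-- `⟪v, ω × v⟫ = 0`. [folklore] -/
private theorem inner_self_cross_right' (b v : EuclideanSpace ℝ (Fin 3)) : ⟪v, cross b v⟫ = 0 := by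
  simp only [cross, PiLp.inner_apply, cross_apply, RCLike.inner_apply, conj_trivial,
    Fin.sum_univ_three, Matrix.cons_val_zero, Matrix.cons_val_one, Matrix.cons_val_two,
    Matrix.head_cons, Matrix.tail_cons]
  ring

/-- The rigid rotation field is divergence free: `div (ω × x) = tr [ω]_× = 0`. [folklore] -/
theorem isDivFree_cross (b : EuclideanSpace ℝ (Fin 3)) :
    VectorCalculus.IsDivFree fun x : EuclideanSpace ℝ (Fin 3) => cross b x := by
  intro x
  have h1 : (fun x : EuclideanSpace ℝ (Fin 3) => cross b x) = ⇑(crossCLM b) := by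
    funext y; rw [crossCLM_apply]
  rw [h1, divergence_eq_sum_inner_fderiv (EuclideanSpace.basisFun (Fin 3) ℝ),
    ContinuousLinearMap.fderiv]
  simp only [crossCLM_apply, inner_self_cross_right', Finset.sum_const_zero]

/-- **The localised swirl is divergence free**:
`div(χ(‖x‖²) ω × x) = χ(‖x‖²) div(ω × x) + Dχ(‖·‖²)(x)(ω × x) = 0 + 0`. [folklore] -/
theorem isDivFree_radial_cross (hχ : Differentiable ℝ χ) (b : EuclideanSpace ℝ (Fin 3)) :
    VectorCalculus.IsDivFree fun x : EuclideanSpace ℝ (Fin 3) => χ (‖x‖ ^ 2) • cross b x := by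
  intro x
  have hn : Differentiable ℝ fun y : EuclideanSpace ℝ (Fin 3) => ‖y‖ ^ 2 :=
    (contDiff_norm_sq ℝ (n := 1)).differentiable one_ne_zero
  have hc : DifferentiableAt ℝ (fun y : EuclideanSpace ℝ (Fin 3) => χ (‖y‖ ^ 2)) x :=
    (hχ.comp hn) x
  have hT : DifferentiableAt ℝ (fun y : EuclideanSpace ℝ (Fin 3) => cross b y) x :=
    (crossCLM b).differentiableAt
  rw [Shvydkoy2018.divergence_smul_apply (EuclideanSpace.basisFun (Fin 3) ℝ) hc hT,
    isDivFree_cross b x, mul_zero, zero_add, fderiv_radial_apply_cross hχ]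

/-! ## §3 A nonzero smooth compactly supported divergence-free rung-one field -/

/-- **The data classes of the low rungs are inhabited by nonzero fields**: there is a smooth,
compactly supported, divergence-free vector field on `ℝ³`, band-limited of degree `≤ 1` (hence of
every degree `L ≥ 1`), which is not identically zero — the localised swirl `χ(‖x‖²) e₂ × x` with
a smooth bump `χ`, `χ = 1` on `[−1, 1]`. [folklore] -/
theorem exists_nonzero_bandLimited_one_divFree_compactSupport :
    ∃ v : EuclideanSpace ℝ (Fin 3) → EuclideanSpace ℝ (Fin 3),
      IsBandLimited 1 v ∧ VectorCalculus.IsDivFree v ∧ HasCompactSupport v ∧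
        ContDiff ℝ ∞ v ∧ ∃ x, v x ≠ 0 := by
  let φ : ContDiffBump (0 : ℝ) := ⟨1, 2, one_pos, one_lt_two⟩
  have hφs : ContDiff ℝ ∞ (φ : ℝ → ℝ) := φ.contDiff
  have hφd : Differentiable ℝ (φ : ℝ → ℝ) := hφs.differentiable (by simp)
  refine ⟨fun x => φ (‖x‖ ^ 2) • cross (axis 2) x, isBandLimited_one_radial_cross hφs _,
    isDivFree_radial_cross hφd _, hasCompactSupport_radial_cross φ.hasCompactSupport _,
    (isBandLimited_one_radial_cross hφs _).1, axis 0, ?_⟩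
  have hn : ‖axis (0 : Fin 3)‖ ^ 2 = 1 := by
    rw [EuclideanSpace.norm_sq_eq]
    simp [axis_apply]
  have h1 : φ (‖axis (0 : Fin 3)‖ ^ 2) = 1 := by
    apply φ.one_of_mem_closedBall
    rw [hn, Metric.mem_closedBall, dist_zero_right, norm_one]
  intro h0
  have h0' : φ (‖axis (0 : Fin 3)‖ ^ 2) • cross (axis 2) (axis 0) = 0 := h0
  rw [h1, one_smul] at h0'
  have h2 := congrArg (fun v : EuclideanSpace ℝ (Fin 3) => v 1) h0'
  simp [cross, cross_apply, axis_apply] at h2
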